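import Summits.Ventures.PercRepro.RankLevelSetHallCoopShareReceipt
import Summits.Ventures.PercRepro.RankLevelSetHallLostTransport

/-!
# PercRepro — THE DEFECT TRANSPORT (TR) HOLDS AT `k = 2`: THE BIG PART OF THE COLOOP-SHARE KERNEL IS A `BigTransport`
(p4, gen 37; paper proofs/P4-CRUX-K2.md, Remark 2; C-044, UP form, tight layer `#E = 2q + 2`)

The coloop-share weight restricted to the big `Y`-sets (`#T ≥ p = q + 2`) is a transport of the LYM defects
`lymDefect M (q+2) q Z = #(cl Z ∖ Z)/(q+1)` in the sense of `BigTransport` (p709299): non-negative, supported on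
`Z ⊆ T ∈ bigY`, loads `≤ 1` (a subsum of `csWeight_load_le_one`), and receipts `≥ d/(q+1)` — the pairs `(R, o)` with
`Z ⊊ R ⊆ cl Z`, `o ∉ cl Z` give sets of size `≥ q + 2`, and `(q + 2 − d) · Σ_{j ≥ 1} C(d,j)/C(q+j+1, j+1) ≥ d/(q+1)`
is the identity of the arithmetic module minus its `j = 0` term.  So **(TR) is a theorem at `k = 2`**
(`bigTransport_k2`), and the lane's transfer `hallUp_of_ncard_eq_of_bigTransport` gives the UP-Hall form a second time.

* `receipt_bound_big` — `d/(q+1) ≤ (q + 2 − d) · Σ_{1 ≤ j ≤ d} C(d,j)/C(q+j+1, j+1)` for `d ≤ q`;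
* `lymDefect_k2` — `lymDefect M (q+2) q Z = #(cl Z ∖ Z)/(q+1)`;
* `bigWeight`, `lymDefect_le_bigWeight_recv`;
* **`bigTransport_k2`** — `#E = 2q + 2 ⇒ BigTransport M (q+2) q`.
Axioms: standard.
-/

namespace PercRepro

open Set Matroid Finset

/-- **The big part of the receipt identity**: for `d ≤ q`,
`d/(q + 1) ≤ (q + 2 − d) · Σ_{1 ≤ j ≤ d} C(d, j)/C(q + j + 1, j + 1)`. -/
theorem CoopShare.receipt_bound_big (q d : ℕ) (hd : d ≤ q) :
    (d : ℚ) / ((q : ℚ) + 1)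
      ≤ ((q : ℚ) + 2 - d) * ∑ j ∈ Finset.Ico 1 (d + 1), (d.choose j : ℚ) / ((q + j + 1).choose (j + 1) : ℚ) := by
  have h := CoopShare.receipt_bound q d hd
  have hsplit : ∑ j ∈ Finset.range (d + 1), (d.choose j : ℚ) / ((q + j + 1).choose (j + 1) : ℚ)
      = (d.choose 0 : ℚ) / ((q + 0 + 1).choose (0 + 1) : ℚ)
        + ∑ j ∈ Finset.Ico 1 (d + 1), (d.choose j : ℚ) / ((q + j + 1).choose (j + 1) : ℚ) := by
    rw [Finset.range_eq_Ico, ← Finset.sum_Ico_consecutive _ (Nat.zero_le 1) (by omega : 1 ≤ d + 1)]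
    simp
  have h0 : (d.choose 0 : ℚ) / ((q + 0 + 1).choose (0 + 1) : ℚ) = 1 / ((q : ℚ) + 1) := by
    simp
  rw [hsplit, h0] at h
  have hq : (0 : ℚ) < (q : ℚ) + 1 := by positivity
  have hdq : (d : ℚ) ≤ (q : ℚ) + 2 := by
    have : (d : ℚ) ≤ q := by exact_mod_cast hd
    linarith
  -- (q+2)/(q+1) ≤ (q+2−d)(1/(q+1) + Σ) ⟹ d/(q+1) ≤ (q+2−d) Σ
  have : ((q : ℚ) + 2) / ((q : ℚ) + 1) - ((q : ℚ) + 2 - d) * (1 / ((q : ℚ) + 1)) = (d : ℚ) / ((q : ℚ) + 1) := by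
    field_simp
    ring
  linarith [mul_add ((q : ℚ) + 2 - d) (1 / ((q : ℚ) + 1))
    (∑ j ∈ Finset.Ico 1 (d + 1), (d.choose j : ℚ) / ((q + j + 1).choose (j + 1) : ℚ))]

variable {α : Type} (M : Matroid α) [M.Finite]

omit [M.Finite] in
/-- At `k = 2` the LYM defect is `#(cl Z ∖ Z)/(q + 1)`. -/
theorem lymDefect_k2 (q : ℕ) (Z : Set α) :
    lymDefect M (q + 2) q Z = ((M.closure Z \ Z).ncard : ℚ) / ((q : ℚ) + 1) := by
  unfold lymDefect
  have hr : q + 2 - q - 1 = 1 := by omega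
  rw [hr, Finset.sum_range_one]
  have hfp : flatPart M Z = M.closure Z \ Z := by
    unfold flatPart
    ext x
    simp only [Set.mem_inter_iff, Set.mem_sdiff]
    constructor
    · rintro ⟨⟨-, hxZ⟩, hxcl⟩
      exact ⟨hxcl, hxZ⟩
    · rintro ⟨hxcl, hxZ⟩
      exact ⟨⟨M.closure_subset_ground Z hxcl, hxZ⟩, hxcl⟩
  rw [hfp]
  simp only [Nat.choose_one_right, zero_add]
  have : ((q + 1).choose q : ℚ) = (q : ℚ) + 1 := by
    rw [Nat.choose_succ_self_right]
    push_cast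
    ring
  rw [this]

/-- The coloop-share weight on the big `Y`-sets (`#T ≥ q + 2`), zero elsewhere. -/
noncomputable def bigWeight (q : ℕ) (Z T : Set α) : ℚ := by
  classical
  exact if q + 2 ≤ T.ncard then csWeight M q Z T else 0

omit [M.Finite] in
/-- The big weight is non-negative. -/
theorem bigWeight_nonneg (q : ℕ) (Z T : Set α) : 0 ≤ bigWeight M q Z T := by
  classical
  unfold bigWeight
  split_ifs
  · exact csWeight_nonneg M q Z T
  · exact le_rfl

omit [M.Finite] in
/-- The big weight is supported on `Z ⊆ T ∈ bigY`. -/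
theorem bigWeight_support (q : ℕ) (Z T : Set α) (h : bigWeight M q Z T ≠ 0) : Z ⊆ T ∧ T ∈ bigY M (q + 2) q := by
  classical
  unfold bigWeight at h
  split_ifs at h with hT
  · refine ⟨subset_of_csWeight_ne_zero M q Z T h, ?_, hT⟩
    unfold csWeight at h
    split_ifs at h with hc
    · exact hc.2.1
    · exact absurd rfl h
  · exact absurd rfl h

/-- The big weight loads every big `Y`-set at most `1`. -/
theorem bigWeight_load_le_one (q : ℕ) {T : Set α} (hT : T ∈ bigY M (q + 2) q) :
    ∑ Z ∈ (cellMembers_finite M (q + 2) q).toFinset, bigWeight M q Z T ≤ 1 := by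
  classical
  have h := csWeight_load_le_one M q hT.1
  refine le_trans (le_of_eq ?_) h
  apply Finset.sum_congr rfl
  intro Z _
  unfold bigWeight
  rw [if_pos hT.2]

/-- **Every member recovers its LYM defect from the big sets**: the pairs `(R, o)` with `Z ⊊ R ⊆ cl Z`, `o ∉ cl Z`,
give `C(d, j)` big sets at each level `j ≥ 1` for each of the `ω = q + 2 − d` outside elements, each paying at least
`1 / C(q + j + 1, j + 1)`; `receipt_bound_big` closes. -/
theorem lymDefect_le_bigWeight_recv (q : ℕ) (hE : M.E.ncard = (q + 2) + q) {Z : Set α}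
    (hZ : Z ∈ cellMembers M (q + 2) q) :
    lymDefect M (q + 2) q Z ≤ ∑ T ∈ (bigY_finite M (q + 2) q).toFinset, bigWeight M q Z T := by
  classical
  have hZE : Z ⊆ M.E := hZ.1
  have hZq : Z.ncard = q := ncard_eq_q_of_mem_cellMembers_tight M hE hZ
  set F : Set α := M.closure Z with hF
  have hFE : F ⊆ M.E := M.closure_subset_ground Z
  have hZF : Z ⊆ F := M.subset_closure Z hZE
  set D : Set α := F \ Z with hD
  set O : Set α := M.E \ F with hO
  have hEfin : M.E.Finite := M.set_finite M.E
  have hFfin : F.Finite := hEfin.subset hFE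
  have hDfin : D.Finite := hFfin.subset sdiff_subset
  have hOfin : O.Finite := hEfin.subset sdiff_subset
  have hDind : M.Indep D := (compl_indep_of_mem_U M hE hZ).1.subset (fun x hx => ⟨hFE hx.1, hx.2⟩)
  have hd_le : D.ncard ≤ q := by
    have h := hDind.encard_le_eRk_of_subset (sdiff_subset : D ⊆ F)
    rw [hF, M.eRk_closure_eq, eRk_eq_of_mem_cellMembers M q hZ, ← hDfin.cast_ncard_eq] at h
    exact_mod_cast h
  have hFcard : F.ncard = q + D.ncard := by
    have := Set.ncard_sdiff_add_ncard_of_subset hZF hFfin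
    rw [← hD, hZq] at this
    omega
  have hOcard : O.ncard = q + 2 - D.ncard := by
    have := Set.ncard_sdiff_add_ncard_of_subset hFE hEfin
    rw [← hO, hE, hFcard] at this
    omega
  set Df : Finset α := hDfin.toFinset with hDf
  set Of : Finset α := hOfin.toFinset with hOf
  have hDcard : Df.card = D.ncard := by rw [hDf, ← ncard_eq_toFinset_card _ hDfin]
  have hOcard' : Of.card = O.ncard := by rw [hOf, ← ncard_eq_toFinset_card _ hOfin]
  set Bf : Finset (Set α) := (bigY_finite M (q + 2) q).toFinset with hBf
  have hmemB : ∀ S, S ∈ Bf ↔ S ∈ bigY M (q + 2) q := fun S => by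
    rw [hBf, (bigY_finite M (q + 2) q).mem_toFinset]
  -- the pairs (Y', o) with Y' nonempty
  set P : Finset (Finset α × α) := (Df.powerset.filter (fun Y => Y.Nonempty)) ×ˢ Of with hP
  let φ : Finset α × α → Set α := fun p => insert p.2 (Z ∪ (p.1 : Set α))
  have hpair : ∀ p ∈ P, (p.1 : Set α) ⊆ D ∧ p.2 ∈ M.E ∧ p.2 ∉ F ∧ p.1.Nonempty := by
    intro p hp
    rw [hP, Finset.mem_product, Finset.mem_filter, Finset.mem_powerset] at hp
    obtain ⟨⟨h1, h1'⟩, h2⟩ := hp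
    refine ⟨?_, ?_, ?_, h1'⟩
    · intro x hx
      have := h1 (Finset.mem_coe.1 hx)
      rw [hDf, Set.Finite.mem_toFinset] at this
      exact this
    · rw [hOf, Set.Finite.mem_toFinset] at h2
      exact h2.1
    · rw [hOf, Set.Finite.mem_toFinset] at h2
      exact h2.2
  have hR : ∀ p ∈ P, Z ⊆ Z ∪ (p.1 : Set α) ∧ Z ∪ (p.1 : Set α) ⊆ F := by
    intro p hp
    obtain ⟨h1, -, -, -⟩ := hpair p hp
    exact ⟨Set.subset_union_left, Set.union_subset hZF (h1.trans sdiff_subset)⟩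
  have hRcard : ∀ p ∈ P, (Z ∪ (p.1 : Set α)).ncard = q + p.1.card := by
    intro p hp
    obtain ⟨h1, -, -, -⟩ := hpair p hp
    have hdisj : Disjoint Z (p.1 : Set α) := by
      rw [Set.disjoint_left]
      intro x hxZ hxY
      exact (h1 hxY).2 hxZ
    rw [Set.ncard_union_eq hdisj (M.set_finite Z hZE) (Finset.finite_toSet _), hZq, ncard_coe_finset]
  -- the image lies in Bf: rank q + 1 and size q + 1 + #Y' ≥ q + 2
  have himage : P.image φ ⊆ Bf := by
    intro S hS
    rw [Finset.mem_image] at hS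
    obtain ⟨p, hp, rfl⟩ := hS
    obtain ⟨-, ho, hocl, hne⟩ := hpair p hp
    obtain ⟨hZR, hRcl⟩ := hR p hp
    rw [hmemB]
    refine ⟨mem_cellY_insert M q hZ hZR hRcl ho hocl, ?_⟩
    have hoR : p.2 ∉ Z ∪ (p.1 : Set α) := fun h => hocl (hRcl h)
    show q + 2 ≤ (insert p.2 (Z ∪ (p.1 : Set α))).ncard
    rw [Set.ncard_insert_of_notMem hoR ((M.set_finite _ (hRcl.trans hFE))), hRcard p hp]
    have : 1 ≤ p.1.card := Finset.card_pos.2 hne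
    omega
  have hinj : ∀ p ∈ P, ∀ p' ∈ P, φ p = φ p' → p = p' := by
    intro p hp p' hp' heq
    obtain ⟨h1, -, hocl, -⟩ := hpair p hp
    obtain ⟨h1', -, hocl', -⟩ := hpair p' hp'
    obtain ⟨hZR, hRcl⟩ := hR p hp
    obtain ⟨hZR', hRcl'⟩ := hR p' hp'
    obtain ⟨hs1, hs2⟩ := insert_sdiff_closure_eq M Z _ hRcl hocl
    obtain ⟨hs1', hs2'⟩ := insert_sdiff_closure_eq M Z _ hRcl' hocl'
    have ho : p.2 = p'.2 := by
      have : ({p.2} : Set α) = {p'.2} := by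
        rw [← hs1, ← hs1']
        show φ p \ M.closure Z = φ p' \ M.closure Z
        rw [heq]
      exact Set.singleton_eq_singleton_iff.1 this
    have hY : p.1 = p'.1 := by
      have hU : Z ∪ (p.1 : Set α) = Z ∪ (p'.1 : Set α) := by
        rw [← hs2, ← hs2']
        show φ p ∩ M.closure Z = φ p' ∩ M.closure Z
        rw [heq]
      have hdiff : ∀ (Y : Finset α), (Y : Set α) ⊆ D → (Z ∪ (Y : Set α)) \ Z = (Y : Set α) := by
        intro Y hY
        ext x
        simp only [Set.mem_sdiff, Set.mem_union]
        constructor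
        · rintro ⟨h | h, hx⟩
          · exact absurd h hx
          · exact h
        · intro h
          exact ⟨Or.inr h, (hY h).2⟩
      have : (p.1 : Set α) = (p'.1 : Set α) := by
        rw [← hdiff p.1 h1, ← hdiff p'.1 h1', hU]
      exact Finset.coe_injective this
    exact Prod.ext hY ho
  have hbig : ∀ S ∈ Bf, bigWeight M q Z S = csWeight M q Z S := by
    intro S hS
    rw [hmemB] at hS
    unfold bigWeight
    rw [if_pos hS.2]
  have hstep1 : ∑ S ∈ P.image φ, csWeight M q Z S ≤ ∑ S ∈ Bf, bigWeight M q Z S := by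
    rw [Finset.sum_congr rfl hbig]
    exact Finset.sum_le_sum_of_subset_of_nonneg himage (fun S _ _ => csWeight_nonneg M q Z S)
  have hstep2 : ∑ S ∈ P.image φ, csWeight M q Z S = ∑ p ∈ P, csWeight M q Z (φ p) :=
    Finset.sum_image hinj
  have hstep3 : ∑ p ∈ P, (1 / (((q + p.1.card + 1).choose (p.1.card + 1) : ℕ) : ℚ))
      ≤ ∑ p ∈ P, csWeight M q Z (φ p) := by
    apply Finset.sum_le_sum
    intro p hp
    obtain ⟨-, ho, hocl, -⟩ := hpair p hp
    obtain ⟨hZR, hRcl⟩ := hR p hp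
    have h := csWeight_insert_ge M q hE hZ hZR hRcl ho hocl
    rw [hRcard p hp, Nat.add_sub_cancel_left] at h
    exact h
  -- evaluate: Σ over nonempty Y' = Σ over all Y' minus the empty term
  have hstep4 : ∑ p ∈ P, (1 / (((q + p.1.card + 1).choose (p.1.card + 1) : ℕ) : ℚ))
      = (Of.card : ℚ) * ∑ j ∈ Finset.Ico 1 (Df.card + 1),
          ((Df.card.choose j : ℕ) : ℚ) * (1 / (((q + j + 1).choose (j + 1) : ℕ) : ℚ)) := by
    rw [hP, Finset.sum_product]
    simp only [Finset.sum_const, nsmul_eq_mul]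
    rw [← Finset.mul_sum]
    congr 1
    -- Σ_{Y' ∈ powerset, Y' nonempty} g(#Y') = Σ_{Y' ∈ powerset} g(#Y') − g(0)
    have hfull := Finset.sum_powerset_apply_card (fun m => (1 / (((q + m + 1).choose (m + 1) : ℕ) : ℚ))) (x := Df)
    have hsplitP : ∑ Y ∈ Df.powerset, (1 / (((q + Y.card + 1).choose (Y.card + 1) : ℕ) : ℚ))
        = ∑ Y ∈ Df.powerset.filter (fun Y => Y.Nonempty), (1 / (((q + Y.card + 1).choose (Y.card + 1) : ℕ) : ℚ))
          + (1 / (((q + 0 + 1).choose (0 + 1) : ℕ) : ℚ)) := by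
      rw [← Finset.sum_filter_add_sum_filter_not Df.powerset (fun Y => Y.Nonempty)]
      congr 1
      have hempty : Df.powerset.filter (fun Y => ¬ Y.Nonempty) = {∅} := by
        ext Y
        simp only [Finset.mem_filter, Finset.mem_powerset, Finset.mem_singleton, Finset.not_nonempty_iff_eq_empty]
        constructor
        · rintro ⟨-, h⟩; exact h
        · intro h; rw [h]; exact ⟨Finset.empty_subset _, rfl⟩
      rw [hempty, Finset.sum_singleton, Finset.card_empty]
    have hsplitJ : ∑ j ∈ Finset.range (Df.card + 1), ((Df.card.choose j : ℕ) : ℚ) * (1 / (((q + j + 1).choose (j + 1) : ℕ) : ℚ))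
        = ∑ j ∈ Finset.Ico 1 (Df.card + 1), ((Df.card.choose j : ℕ) : ℚ) * (1 / (((q + j + 1).choose (j + 1) : ℕ) : ℚ))
          + (1 / (((q + 0 + 1).choose (0 + 1) : ℕ) : ℚ)) := by
      rw [Finset.range_eq_Ico, ← Finset.sum_Ico_consecutive _ (Nat.zero_le 1) (by omega : 1 ≤ Df.card + 1)]
      simp only [Finset.sum_Ico_succ_top (Nat.zero_le 0), Finset.Ico_self, Finset.sum_empty, zero_add, Nat.choose_zero_right, Nat.cast_one, one_mul]
      ring
    have hfull' : ∑ Y ∈ Df.powerset, (1 / (((q + Y.card + 1).choose (Y.card + 1) : ℕ) : ℚ))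
        = ∑ j ∈ Finset.range (Df.card + 1), ((Df.card.choose j : ℕ) : ℚ) * (1 / (((q + j + 1).choose (j + 1) : ℕ) : ℚ)) := by
      rw [hfull]
      apply Finset.sum_congr rfl
      intro j _
      rw [nsmul_eq_mul]
    linarith [hsplitP, hsplitJ, hfull']
  have harith := CoopShare.receipt_bound_big q D.ncard hd_le
  have hOq : (Of.card : ℚ) = (q : ℚ) + 2 - (D.ncard : ℚ) := by
    rw [hOcard', hOcard, Nat.cast_sub (by omega)]
    push_cast
    ring
  rw [lymDefect_k2]
  calc ((M.closure Z \ Z).ncard : ℚ) / ((q : ℚ) + 1) = (D.ncard : ℚ) / ((q : ℚ) + 1) := by rw [hD]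
    _ ≤ ((q : ℚ) + 2 - D.ncard) * ∑ j ∈ Finset.Ico 1 (D.ncard + 1),
          (D.ncard.choose j : ℚ) / ((q + j + 1).choose (j + 1) : ℚ) := harith
    _ = (Of.card : ℚ) * ∑ j ∈ Finset.Ico 1 (Df.card + 1),
          ((Df.card.choose j : ℕ) : ℚ) * (1 / (((q + j + 1).choose (j + 1) : ℕ) : ℚ)) := by
        rw [hOq, hDcard]
        congr 1
        apply Finset.sum_congr rfl
        intro j _
        rw [mul_one_div]
    _ = ∑ p ∈ P, (1 / (((q + p.1.card + 1).choose (p.1.card + 1) : ℕ) : ℚ)) := hstep4.symm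
    _ ≤ ∑ p ∈ P, csWeight M q Z (φ p) := hstep3
    _ = ∑ S ∈ P.image φ, csWeight M q Z S := hstep2.symm
    _ ≤ ∑ S ∈ Bf, bigWeight M q Z S := hstep1

/-- **(TR) HOLDS AT `k = 2`**: at `#E = 2q + 2` the big part of the coloop-share kernel is a `BigTransport`. -/
theorem bigTransport_k2 (q : ℕ) (hE : M.E.ncard = (q + 2) + q) : BigTransport M (q + 2) q :=
  ⟨bigWeight M q, bigWeight_nonneg M q, bigWeight_support M q,
    fun _ hZ => lymDefect_le_bigWeight_recv M q hE hZ, fun _ hT => bigWeight_load_le_one M q hT⟩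

end PercRepro
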